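import Literature.Combinatorics.Optimization.StableSetPolytopeAdjacency
import Mathlib.Combinatorics.SimpleGraph.LineGraph
import HarnessLib

/-!
# The matching polytope is the stable set polytope of the line graph; Chvátal's Corollary 6.3 from
# Theorem 6.2 via `L(G)` (Chvátal 1975, §6, p. 150) — PROVED

Source (held, read at the page): V. Chvátal, *On certain polytopes associated with graphs*
[Chvatal1975] (held text `paper:doi-10-1016-0095-8956-75-90041-6`, p. 150, the paragraph between the
proof of Theorem 6.2 and Corollary 6.3): "The natural correspondence between sets of edges in a graph
`G = (V, E)` and sets of vertices in its line-graph `L(G)` has some nice properties. Firstly, matchings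
in `G` correspond to stable sets in `L(G)` and vice versa. Secondly, the subgraph of `L(G)` induced by
`X` is connected if and only if the subgraph of `G` defined by `X` (that is, obtained from `(V, X)` by
deleting all isolated vertices) is connected. Hence Theorem 6.2 yields instantly the answer to
Balinski's question. COROLLARY 6.3. Matchings `M₁, M₂` in a graph `G` are neighbors in the matching
polyhedron if and only if their symmetric difference `(M₁ − M₂) ∪ (M₂ − M₁)` defines a connected graph."

presearch: "line graph stable sets matchings matching polytope stable set polytope of line graph" →
[corpus: paper:doi-10-1016-0095-8956-75-90041-6 p. 150] (used); tree: Mathlib `SimpleGraph.lineGraph`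
(`lineGraph_adj_iff_exists`), the tree's `MatchingAdjacency.EAdj` is the same adjacency; Theorem 6.2 is
`StableSetAdjacency.Chvatal1975_thm62`, Cor. 6.3 (direct proof) is
`MatchingAdjacency.Chvatal1975_cor63_matching`; the identification `STAB(L(G)) = C(G)` was not typed.

## What is typed (0 named facts; all PROVED)

| item | Lean | status |
|---|---|---|
| "matchings in `G` correspond to stable sets in `L(G)`" | `isIndepSet_lineGraph_iff` | PROVED |
| `χ^S` (vertex set of `L(G)`) = `χ^S` (edge set of `G`); `S(L(G)) = P(G)`; **`STAB(L(G)) = C(G)`** (Edmonds' polytope, via the tree's matching polytope theorem `edmondsPolytope_eq_convexHull`) | `charVec_eq_indVec`, `stableSetVectors_lineGraph`, **`stab_lineGraph`** | PROVED |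
| the graph `(V, X)`; `(V, S₁ △ S₂)` of the adjacency file is `edgeGraph (S₁ △ S₂)` | `edgeGraph`, `edgeGraph_adj`, `diffGraph_eq_edgeGraph` | DEF + PROVED |
| walk transfer `L(G)[X] ⇄ (V, X)` | `reachable_of_lineReachable`, `lineReachable_of_walk` | PROVED |
| "the subgraph of `L(G)` induced by `X` is connected iff the subgraph of `G` defined by `X` is connected" (`X ≠ ∅`; "defined by" = one non-trivial component of `(V, X)`) | **`connected_lineGraph_induce_iff`** | PROVED |
| "Hence Theorem 6.2 yields instantly … Corollary 6.3" — Cor. 6.3 re-derived from `Chvatal1975_thm62` applied to `L(G)` | **`Chvatal1975_cor63_via_lineGraph`** | PROVED |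

Typing decisions. Same currencies as the sibling files: adjacency = exposed segment (`IsExposed ℝ`),
`C(G) = edmondsPolytope G`, "connected subgraph defined by `X`" = `PolytopeGraph.HasOneNontrivialComponent`
of `(V, X)`, "induced subgraph of `L(G)` connected" = Mathlib `(G.lineGraph.induce ↑X).Connected`.
-/

noncomputable section

open Finset

namespace Literature.Combinatorics.Optimization

namespace LineGraphMatching

open Literature.Algebra.Polynomial.ThetaBodiesStableSet StableSetAdjacency MatchingAdjacency
  StephenTuncel1999

variable {V : Type*} [DecidableEq V] {G : SimpleGraph V}

/-! ## §1 Matchings of `G` = stable sets of `L(G)`; the matching polytope = `STAB(L(G))` -/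

omit [DecidableEq V] in
/-- "matchings in `G` correspond to stable sets in `L(G)` and vice versa": an edge set is a matching iff
it is an independent set of the line graph. [cite: Chvatal1975, §6 (p. 150)] -/
theorem isIndepSet_lineGraph_iff (S : Finset G.edgeSet) :
    G.lineGraph.IsIndepSet (S : Set G.edgeSet) ↔ IsMatchingSet S := by
  constructor
  · intro h e he f hf hef v hve hvf
    exact h (Finset.mem_coe.2 he) (Finset.mem_coe.2 hf) hef
      (SimpleGraph.lineGraph_adj_iff_exists.2 ⟨hef, v, hve, hvf⟩)
  · intro h e he f hf hef hadj
    obtain ⟨-, v, hve, hvf⟩ := SimpleGraph.lineGraph_adj_iff_exists.1 hadj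
    exact h e (Finset.mem_coe.1 he) f (Finset.mem_coe.1 hf) hef v hve hvf

/-- The incidence vector of an edge set is its characteristic vector as a vertex set of `L(G)` (same
coordinates `ℝ^{E(G)} = ℝ^{V(L(G))}`). [cite: Chvatal1975, §6 (p. 150)] -/
theorem charVec_eq_indVec (S : Finset G.edgeSet) : charVec S = indVec S := rfl

variable [Fintype V] [DecidableRel G.Adj]

/-- `S(L(G)) = P(G)`: the stable-set vectors of the line graph are the matching vectors of `G`.
[cite: Chvatal1975, §6 (p. 150)] -/
theorem stableSetVectors_lineGraph : stableSetVectors G.lineGraph = matchingVectors G := by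
  ext x
  rw [mem_stableSetVectors_iff, mem_matchingVectors_iff]
  constructor
  · rintro ⟨S, hS, rfl⟩
    exact ⟨S, (isIndepSet_lineGraph_iff S).1 hS, rfl⟩
  · rintro ⟨S, hS, rfl⟩
    exact ⟨S, (isIndepSet_lineGraph_iff S).2 hS, rfl⟩

/-- **The matching polytope of `G` is the stable set polytope of its line graph**:
`STAB(L(G)) = conv P(G) = C(G)` (Edmonds' polytope, by the tree's matching polytope theorem).
[cite: Chvatal1975, §6 (p. 150)] -/
theorem stab_lineGraph : stab G.lineGraph = edmondsPolytope G := by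
  unfold stab
  rw [stableSetVectors_lineGraph, ← edmondsPolytope_eq_convexHull]

/-! ## §2 "The subgraph of `L(G)` induced by `X` is connected iff the subgraph of `G` defined by `X` is connected" -/

omit [Fintype V] [DecidableRel G.Adj]

/-- The graph `(V, X)` ("the subgraph of `G` defined by `X` … obtained from `(V, X)` by deleting all
isolated vertices" — kept here on all of `V`). [cite: Chvatal1975, §6 (p. 150)] -/
def edgeGraph (X : Finset G.edgeSet) : SimpleGraph V :=
  SimpleGraph.fromEdgeSet (Subtype.val '' (X : Set G.edgeSet))

omit [DecidableEq V] in
/-- Adjacency in `(V, X)`. [cite: Chvatal1975, §6 (p. 150)] -/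
theorem edgeGraph_adj {X : Finset G.edgeSet} {u w : V} :
    (edgeGraph X).Adj u w ↔ ∃ e ∈ X, (e : Sym2 V) = s(u, w) := by
  unfold edgeGraph
  rw [SimpleGraph.fromEdgeSet_adj]
  constructor
  · rintro ⟨⟨e, he, heq⟩, -⟩
    exact ⟨e, Finset.mem_coe.1 he, heq⟩
  · rintro ⟨e, he, heq⟩
    refine ⟨⟨e, Finset.mem_coe.2 he, heq⟩, ?_⟩
    intro huw
    have := G.not_isDiag_of_mem_edgeSet e.2
    rw [heq, huw] at this
    exact this rfl

/-- `(V, S₁ △ S₂)` of `MatchingPolytopeAdjacency.lean` is `edgeGraph (S₁ △ S₂)`. [cite: Chvatal1975, Cor. 6.3 (p. 150)] -/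
theorem diffGraph_eq_edgeGraph (S₁ S₂ : Finset G.edgeSet) : diffGraph S₁ S₂ = edgeGraph (symmDiff S₁ S₂) :=
  rfl

omit [DecidableEq V] in
/-- Two end points of one edge of `X` are equal or adjacent in `(V, X)`. [cite: Chvatal1975, §6 (p. 150)] -/
theorem reachable_of_mem_mem {X : Finset G.edgeSet} {e : G.edgeSet} (he : e ∈ X) {u w : V}
    (hu : u ∈ (e : Sym2 V)) (hw : w ∈ (e : Sym2 V)) : (edgeGraph X).Reachable u w := by
  by_cases huw : u = w
  · subst huw; exact SimpleGraph.Reachable.refl _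
  · exact (edgeGraph_adj.2 ⟨e, he, (Sym2.mem_and_mem_iff huw).1 ⟨hu, hw⟩⟩).reachable

omit [DecidableEq V] in
/-- **From the line graph to the graph**: an `L(G)`-walk inside `X` from `e` to `f` joins every end of
`e` to every end of `f` in `(V, X)`. [cite: Chvatal1975, §6 (p. 150)] -/
theorem reachable_of_lineReachable {X : Finset G.edgeSet} {e f : G.edgeSet} (he : e ∈ X)
    (h : (resGraph G.lineGraph X).Reachable e f) {u w : V} (hu : u ∈ (e : Sym2 V))
    (hw : w ∈ (f : Sym2 V)) : (edgeGraph X).Reachable u w := by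
  obtain ⟨p⟩ := h
  induction p generalizing u with
  | nil => exact reachable_of_mem_mem he hu hw
  | @cons a b c hab p ih =>
    obtain ⟨hL, haX, hbX⟩ := hab
    obtain ⟨-, v, hva, hvb⟩ := SimpleGraph.lineGraph_adj_iff_exists.1 hL
    exact (reachable_of_mem_mem haX hu hva).trans (ih hbX hvb hw)

omit [DecidableEq V] in
/-- Two edges of `X` through a common vertex are equal or adjacent in `L(G)[X]`.
[cite: Chvatal1975, §6 (p. 150)] -/
theorem lineReachable_of_mem_mem {X : Finset G.edgeSet} {e f : G.edgeSet} (he : e ∈ X) (hf : f ∈ X)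
    {v : V} (hve : v ∈ (e : Sym2 V)) (hvf : v ∈ (f : Sym2 V)) :
    (resGraph G.lineGraph X).Reachable e f := by
  by_cases hef : e = f
  · subst hef; exact SimpleGraph.Reachable.refl _
  · exact (show (resGraph G.lineGraph X).Adj e f from
      ⟨SimpleGraph.lineGraph_adj_iff_exists.2 ⟨hef, v, hve, hvf⟩, he, hf⟩).reachable

omit [DecidableEq V] in
/-- **From the graph to the line graph**: a walk of `(V, X)` from an end of `e ∈ X` to an end of `f ∈ X`
gives an `L(G)`-walk inside `X` from `e` to `f`. [cite: Chvatal1975, §6 (p. 150)] -/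
theorem lineReachable_of_walk {X : Finset G.edgeSet} {u w : V} (p : (edgeGraph X).Walk u w) :
    ∀ {e f : G.edgeSet}, e ∈ X → f ∈ X → u ∈ (e : Sym2 V) → w ∈ (f : Sym2 V) →
      (resGraph G.lineGraph X).Reachable e f := by
  induction p with
  | nil => intro e f he hf hu hw; exact lineReachable_of_mem_mem he hf hu hw
  | @cons a b c hab p ih =>
    intro e f he hf hu hw
    obtain ⟨g, hg, hgab⟩ := edgeGraph_adj.1 hab
    have hag : a ∈ (g : Sym2 V) := by rw [hgab]; exact Sym2.mem_mk_left a b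
    have hbg : b ∈ (g : Sym2 V) := by rw [hgab]; exact Sym2.mem_mk_right a b
    exact (lineReachable_of_mem_mem he hg hu hag).trans (ih hg hf hbg hw)

omit [DecidableEq V] in
/-- Every edge is `s(a, b)` for some `a, b`. [folklore] -/
private theorem sym2_exists (z : Sym2 V) : ∃ a b : V, z = s(a, b) := by
  induction z using Sym2.ind with
  | h a b => exact ⟨a, b, rfl⟩

omit [DecidableEq V] in
/-- **Chvátal's remark** ("the subgraph of `L(G)` induced by `X` is connected if and only if the subgraph
of `G` defined by `X` (that is, obtained from `(V, X)` by deleting all isolated vertices) is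
connected"): for a non-empty edge set `X`, `L(G)[X]` is connected iff `(V, X)` has a single
non-trivial component. [cite: Chvatal1975, §6 (p. 150)] -/
theorem connected_lineGraph_induce_iff {X : Finset G.edgeSet} (hX : X.Nonempty) :
    (G.lineGraph.induce (X : Set G.edgeSet)).Connected ↔
      PolytopeGraph.HasOneNontrivialComponent (edgeGraph X) := by
  rw [connected_induce_iff hX]
  constructor
  · intro h
    obtain ⟨e₀, he₀⟩ := hX
    obtain ⟨a, b, hab⟩ := sym2_exists (e₀ : Sym2 V)
    refine ⟨⟨a, b, edgeGraph_adj.2 ⟨e₀, he₀, hab⟩⟩, fun v w v' w' hvw hv'w' => ?_⟩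
    obtain ⟨g, hg, hgvw⟩ := edgeGraph_adj.1 hvw
    obtain ⟨g', hg', hg'vw⟩ := edgeGraph_adj.1 hv'w'
    exact reachable_of_lineReachable hg (h g hg g' hg') (by rw [hgvw]; exact Sym2.mem_mk_left v w)
      (by rw [hg'vw]; exact Sym2.mem_mk_left v' w')
  · rintro ⟨-, hone⟩ e he f hf
    obtain ⟨a, a', haa⟩ := sym2_exists (e : Sym2 V)
    obtain ⟨b, b', hbb⟩ := sym2_exists (f : Sym2 V)
    obtain ⟨p⟩ := hone (edgeGraph_adj.2 ⟨e, he, haa⟩) (edgeGraph_adj.2 ⟨f, hf, hbb⟩)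
    exact lineReachable_of_walk p he hf (by rw [haa]; exact Sym2.mem_mk_left a a')
      (by rw [hbb]; exact Sym2.mem_mk_left b b')

/-! ## §3 "Hence Theorem 6.2 yields instantly the answer to Balinski's question" (Corollary 6.3 re-derived) -/

/-- **Corollary 6.3 from Theorem 6.2 via the line graph** (Chvátal's own derivation): for matchings
`S₁ ≠ S₂` of `G`, `[χ^{S₁}, χ^{S₂}]` is an exposed face of the matching polytope `C(G) = STAB(L(G))` iff
`(V, S₁ △ S₂)` has a single non-trivial component. (The tree's `Chvatal1975_cor63_matching` proves the
same statement directly; this is the printed road.) [cite: Chvatal1975, Cor. 6.3 (p. 150)] -/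
theorem Chvatal1975_cor63_via_lineGraph [Fintype V] [DecidableRel G.Adj] {S₁ S₂ : Finset G.edgeSet}
    (h₁ : IsMatchingSet S₁) (h₂ : IsMatchingSet S₂) (hne : S₁ ≠ S₂) :
    IsExposed ℝ (edmondsPolytope G) (segment ℝ (indVec S₁) (indVec S₂)) ↔
      PolytopeGraph.HasOneNontrivialComponent (diffGraph S₁ S₂) := by
  rw [← stab_lineGraph, ← charVec_eq_indVec, ← charVec_eq_indVec,
    Chvatal1975_thm62 ((isIndepSet_lineGraph_iff S₁).2 h₁) ((isIndepSet_lineGraph_iff S₂).2 h₂) hne,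
    connected_lineGraph_induce_iff (symmDiff_nonempty hne), diffGraph_eq_edgeGraph]

end LineGraphMatching

end Literature.Combinatorics.Optimization
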